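import Summits.CriticalPhenomena.PercolationContinuityZ3.Theorems.PercNearOneGluingNoHeavyLowerTailSahiCombTriWSandwich

/-!
# The constant certificate: `TriWIneq` for `P` whenever `P` is ANTIPODALLY POSITIVELY CORRELATED on pairs of up-sets

Support file of the one-cut programme (crux `NoHeavyLowerTail`, stmt-CriticalPhenomena-4575; cell `prim-masterthm`, seat P5 gen 24; memo
`FROM-prim-masterthm-p5-g24-SANDWICH.md` §6(b)).  In the SANDWICH language of `…SahiCombTriWSandwich` the simplest certificate is the constant diagonal weight
`κ₁(u,e) = [u = e ∈ P]`, `κ₁(A×B) = #(P ∩ A ∩ B)`.  Its upper inequality `#(P∩A∩B) ≤ U_P(A,B)` is Kleitman's lemma; its lower inequality is EXACTLY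

  `Cor_P(A,B) := #(P∩A∩B) + #(P∩refl A∩refl B) − #(P∩A∩refl B) − #(P∩refl A∩B) = Σ_{w∈P} ([w∈A]−[wᶜ∈A])([w∈B]−[wᶜ∈B]) ≥ 0`

(`FiveUpSet.lForm_eq_card_sub_corP`).  Hence (`FiveUpSet.triW_nonneg_of_corP_nonneg`): if `Cor_P(A,B) ≥ 0` for all up-sets `A, B` of the fibre cube, then `0 ≤ triW P F G` for EVERY
index cube and all monotone families of up-sets.  `Cor_W = 2·(Kleitman gap) ≥ 0`; for a SELF-DUAL `P` (exactly one of `w, wᶜ` in `P`) `2·Cor_P = Cor_W`, which re-proves the tree's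
`triW_nonneg_of_selfDual` (there: rank certificates) in three lines (`FiveUpSet.corP_nonneg_of_selfDual`, `triW_nonneg_of_selfDual'`); principal `P` and the threshold
families `{w | #wᶜ ≤ j}` are further instances (memo §6–7; exact data: 35 of the 167 up-sets of `2^4`).
HONEST LABEL: complete proofs, std axioms; a criterion + one re-derived stratum; which `P` have `Cor_P ≥ 0` in general stays OPEN. [this work]
-/

namespace Summit.CriticalPhenomena.PercolationContinuityZ3.Theorems

namespace FiveUpSet

open Finset

variable {β γ : Type} [DecidableEq β] [Fintype β] [DecidableEq γ] [Fintype γ]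

/-- The ANTIPODAL CORRELATION of `P` on a pair of families: `Cor_P(A,B) = #(P∩A∩B) + #(P∩refl A∩refl B) − #(P∩A∩refl B) − #(P∩refl A∩B)`. [this work] -/
def corP (P A B : Finset (Finset γ)) : ℤ :=
  ((P ∩ A ∩ B).card : ℤ) + (P ∩ refl A ∩ refl B).card - (P ∩ A ∩ refl B).card - (P ∩ refl A ∩ B).card

omit [DecidableEq β] [Fintype β] in
/-- The lower form against the constant certificate: `L_P(A,B) = #(P∩A∩B) − Cor_P(A,B)` (uses `#(refl P∩A∩B) = #(P∩refl A∩refl B)`). [this work] -/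
theorem lForm_eq_card_sub_corP (P A B : Finset (Finset γ)) : lForm P A B = ((P ∩ A ∩ B).card : ℤ) - corP P A B := by
  unfold lForm corP
  rw [card_refl_inter_inter]
  ring

/-- The constant diagonal weight on `P`: `κ₁(u,e) = [u = e ∈ P]`. [this work] -/
def kapOne (P : Finset (Finset γ)) (u e : Finset γ) : ℕ := if u = e ∧ e ∈ P then 1 else 0

omit [DecidableEq β] [Fintype β] in
/-- `κ₁(A × B) = #(P ∩ A ∩ B)`. [this work] -/
theorem ptVal_kapOne (P A B : Finset (Finset γ)) : ptVal (kapOne P) A B = ((P ∩ A ∩ B).card : ℤ) := by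
  unfold ptVal kapOne
  have h1 : ∀ u : Finset γ, ∑ e : Finset γ, ((if u = e ∧ e ∈ P then 1 else 0 : ℕ) : ℤ) * (if u ∈ A then 1 else 0) * (if e ∈ B then 1 else 0)
      = if u ∈ P ∩ A ∩ B then 1 else 0 := by
    intro u
    rw [Finset.sum_eq_single u]
    · by_cases hP : u ∈ P <;> by_cases hA : u ∈ A <;> by_cases hB : u ∈ B <;> simp [hP, hA, hB, mem_inter]
    · intro e _ hne
      rw [if_neg (fun h => hne h.1.symm)]
      simp
    · intro h; exact absurd (mem_univ u) h
  rw [Finset.sum_congr rfl (fun u _ => h1 u), Finset.sum_boole, Finset.filter_univ_mem]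

omit [DecidableEq β] [Fintype β] in
/-- **The constant certificate.**  If `P` is an up-set with `Cor_P(A,B) ≥ 0` for all up-sets `A, B`, then `κ₁` is a sandwich certificate with `c = 1`. [this work] -/
theorem sandwichPt_kapOne {P : Finset (Finset γ)} (hP : IsUpperSet (P : Set (Finset γ)))
    (hcor : ∀ A B : Finset (Finset γ), IsUpperSet (A : Set (Finset γ)) → IsUpperSet (B : Set (Finset γ)) → 0 ≤ corP P A B) :
    SandwichPt P 1 (kapOne P) := by
  intro A B hA hB
  rw [ptVal_kapOne, Nat.cast_one, one_mul, one_mul, lForm_eq_card_sub_corP]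
  refine ⟨by linarith [hcor A B hA hB], ?_⟩
  -- upper: #(P∩A∩B) ≤ 2#(P∩A∩B) − #(refl P∩A∩B), i.e. Kleitman `#(refl P ∩ (A∩B)) ≤ #(P ∩ (A∩B))`
  unfold uForm
  have hAB : IsUpperSet ((A ∩ B : Finset (Finset γ)) : Set (Finset γ)) := by rw [coe_inter]; exact hA.inter hB
  have h := card_refl_inter_le hAB hP
  have h' : ((refl P ∩ A ∩ B).card : ℤ) ≤ ((P ∩ A ∩ B).card : ℤ) := by
    rw [inter_assoc, inter_assoc]
    exact_mod_cast h
  linarith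

/-- **`TriWIneq` for antipodally positively correlated `P`**: `Cor_P ≥ 0` on all pairs of up-sets ⟹ `0 ≤ triW P F G` for every index cube and all monotone families
of up-sets. [this work] -/
theorem triW_nonneg_of_corP_nonneg {P : Finset (Finset γ)} (hP : IsUpperSet (P : Set (Finset γ)))
    (hcor : ∀ A B : Finset (Finset γ), IsUpperSet (A : Set (Finset γ)) → IsUpperSet (B : Set (Finset γ)) → 0 ≤ corP P A B)
    (F G : Finset β → Finset (Finset γ))
    (hF : ∀ x, IsUpperSet (F x : Set (Finset γ))) (hG : ∀ x, IsUpperSet (G x : Set (Finset γ)))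
    (hFm : Monotone F) (hGm : Monotone G) :
    0 ≤ triW P F G :=
  triW_nonneg_of_sandwichPt Nat.one_pos (sandwichPt_kapOne hP hcor) F G hF hG hFm hGm

/-! ### Instances: the whole cube and self-dual families -/

omit [DecidableEq β] [Fintype β] in
/-- `Cor_W(A,B) = 2·(#(A∩B) − #(A ∩ refl B)) ≥ 0` — Kleitman's lemma, twice. [this work] -/
theorem corP_univ_nonneg {A B : Finset (Finset γ)} (hA : IsUpperSet (A : Set (Finset γ))) (hB : IsUpperSet (B : Set (Finset γ))) :
    0 ≤ corP univ A B := by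
  unfold corP
  simp only [univ_inter]
  have h1 := card_inter_refl_le hA hB
  have h2 := card_refl_inter_le hB hA
  have e1 : (refl A ∩ refl B).card = (A ∩ B).card := by rw [← refl_inter, card_refl]
  rw [e1]
  omega

omit [DecidableEq β] [Fintype β] in
/-- For a SELF-DUAL `P` (`wᶜ ∈ P ↔ w ∉ P`): `2·Cor_P = Cor_W`, because each antipodal pair meets `P` exactly once and the summand is invariant under `w ↦ wᶜ`. [this work] -/
theorem two_mul_corP_of_selfDual {P : Finset (Finset γ)} (hsd : ∀ u : Finset γ, uᶜ ∈ P ↔ u ∉ P) (A B : Finset (Finset γ)) :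
    2 * corP P A B = corP univ A B := by
  -- write both sides as sums of the pair summand `s(w) = ([w∈A]−[wᶜ∈A])([w∈B]−[wᶜ∈B])`
  have hs : ∀ Q : Finset (Finset γ), corP Q A B = ∑ w ∈ Q, sgnDiff A (refl A) w * sgnDiff B (refl B) w := by
    intro Q
    unfold corP
    rw [card_inter_inter_eq_sum_ibit, card_inter_inter_eq_sum_ibit, card_inter_inter_eq_sum_ibit, card_inter_inter_eq_sum_ibit,
      ← Finset.sum_add_distrib, ← Finset.sum_sub_distrib, ← Finset.sum_sub_distrib]
    refine Finset.sum_congr rfl fun w _ => ?_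
    unfold sgnDiff ibit
    simp only [mem_refl]
    ring
  rw [hs P, hs univ]
  -- split `univ = P ∪ Pᶜ` and re-index the complement part by `w ↦ wᶜ`
  rw [← Finset.sum_add_sum_compl P]
  have hre : ∑ w ∈ Pᶜ, sgnDiff A (refl A) w * sgnDiff B (refl B) w = ∑ w ∈ P, sgnDiff A (refl A) w * sgnDiff B (refl B) w := by
    refine Finset.sum_nbij' (fun w => wᶜ) (fun w => wᶜ) ?_ ?_ (fun w _ => compl_compl w) (fun w _ => compl_compl w) ?_
    · intro w hw
      rw [mem_compl] at hw
      exact (hsd w).2 hw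
    · intro w hw
      rw [mem_compl]
      intro h
      exact (hsd w).1 h hw
    · intro w _
      unfold sgnDiff
      simp only [mem_refl, compl_compl]
      ring
  rw [hre]
  ring

omit [DecidableEq β] [Fintype β] in
/-- Self-dual `P` are antipodally positively correlated. [this work] -/
theorem corP_nonneg_of_selfDual {P : Finset (Finset γ)} (hsd : ∀ u : Finset γ, uᶜ ∈ P ↔ u ∉ P) {A B : Finset (Finset γ)}
    (hA : IsUpperSet (A : Set (Finset γ))) (hB : IsUpperSet (B : Set (Finset γ))) : 0 ≤ corP P A B := by
  have h := two_mul_corP_of_selfDual hsd A B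
  have h2 := corP_univ_nonneg hA hB
  linarith

/-- **The self-dual stratum, re-proved by the constant sandwich certificate** (cf. `triW_nonneg_of_selfDual` of `…TriWSelfDual`, proved there by rank certificates). [this work] -/
theorem triW_nonneg_of_selfDual' (P : Finset (Finset γ)) (hP : IsUpperSet (P : Set (Finset γ))) (hsd : ∀ u : Finset γ, uᶜ ∈ P ↔ u ∉ P)
    (F G : Finset β → Finset (Finset γ))
    (hF : ∀ x, IsUpperSet (F x : Set (Finset γ))) (hG : ∀ x, IsUpperSet (G x : Set (Finset γ)))
    (hFm : Monotone F) (hGm : Monotone G) :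
    0 ≤ triW P F G :=
  triW_nonneg_of_corP_nonneg hP (fun _ _ hA hB => corP_nonneg_of_selfDual hsd hA hB) F G hF hG hFm hGm

end FiveUpSet

end Summit.CriticalPhenomena.PercolationContinuityZ3.Theorems
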